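import Literature.NumberTheory.Automorphic.IdeleClassGroupCyclicLayerArtinClass
import Literature.NumberTheory.Automorphic.IdeleClassGaloisRepSecondInequality
import Mathlib.RepresentationTheory.Homological.GroupCohomology.Functoriality
import HarnessLib

/-!
# The layer `E/F` of the global module `C_M` as the quotient layer by `Gal(M/E) = ker(res_E)`, for an
# ABSTRACT normal intermediate extension `F ⊆ E ⊆ M` (Tate, Cassels–Fröhlich VII §8 Prop. 8.1; Serre,
# *Local Fields* XI §1 (iv) "transport of structure")

Topic `NumberTheory/Automorphic` (ideles, idele classes); namespace
`Literature.NumberTheory.Automorphic.IdeleClassGroup`.  Proof file: theorems only (no definition, no named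
fact, no instance, no notation; D-0026).  Sequel to `IdeleClassGaloisRepSecondInequality` (§1 there: the
quotient layer by a normal subgroup `N` is the layer `M^N / F` for the FIXED FIELD `M^N ⊆ M`) — here the same
identification for an intermediate extension given as an abstract `F`-algebra `E` with `[Algebra E M]`
(`IsScalarTower F E M`, `E/F` normal), the subgroup being the kernel
`H = ker (AlgEquiv.restrictNormalHom E : Gal(M/F) → Gal(E/F))` ("`Gal(M/E)` as a subgroup of `Gal(M/F)`"):

* §1 `mem_ker_restrictNormalHom_iff` (`g ∈ H ↔ g` fixes `E` pointwise), `restrictScalars_mem_ker`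
  (`Gal(M/E) ⊆ H`), `exists_restrictScalars_eq_of_mem_ker` (`H ⊆ Gal(M/E)`),
  `natCard_quotient_ker_restrictNormalHom` (`#(Gal(M/F)/H) = [E:F]`).
* §2 **`nonempty_iso_quotientToInvariants_ker_galoisRep`**: `Hⁿ(Gal(M/F) ⧸ H, (C_M)^H) ≅ Hⁿ(Gal(E/F), C_E)`
  (transport `groupCohomology.mapIso` along `Gal(M/F) ⧸ H ≅ Gal(E/F)`
  (`QuotientGroup.quotientKerEquivOfSurjective`, `restrictNormalHom_surjective`) and the Galois descent
  `C_E ≅ (C_M)^H` (`classBaseChange E M`, `mem_range_classBaseChange_iff`; equivariance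
  `classGalAct_classBaseChange_tower`)); `natCard_groupCohomology_quotientToInvariants_ker`.
* §3 **`exists_addOrderOf_eq_card_quotient_ker_of_isCyclic`**: for `E/F` CYCLIC, `H²(Gal(M/F) ⧸ H, (C_M)^H)`
  contains a class of order `#(Gal(M/F) ⧸ H) = [E:F]` (door-c6 g8's `isAddCyclic_H2_galoisRep` +
  `natCard_H2_galoisRep_eq_card` transported) — the hypothesis `u` of the engine's
  `CyclicReference.exists_addOrderOf_eq_card_quotient` for the cyclic reference layer.
* §4 **`ofMul_classBaseChange_mem_range_norm_res_ker`**: `ι_{M/E}[Eˣ N_{M/E} 𝕀_M] ⊆ N_H C_M`, the norm of the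
  RESTRICTED representation `Res_H C_M` (reindexing `H ≃ Gal(M/E)`, `classGalAct_restrictScalars`) — the shape of
  the engine's translation input `hT`.

## References
* J. W. S. Cassels, A. Fröhlich (eds.), *Algebraic Number Theory* (1967), Ch. VII (J. Tate) §8 Prop. 8.1, §11.2.
  [CasselsFrohlichANT1967]
* J.-P. Serre, *Local Fields*, GTM 67 (1979), Ch. XI §1 (iv), VII §5–§6. [SerreLocalFields1979]
-/

noncomputable section

open NumberField CategoryTheory CategoryTheory.Limits groupCohomology
open scoped NumberField

namespace Literature.NumberTheory.Automorphic

namespace IdeleClassGroup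

open Literature.NumberTheory.GaloisRepresentations Literature.Algebra.Homology

/-! ## §1. `Gal(M/E)` as the kernel of restriction to the normal sub-extension `E/F` -/

section Kernel

variable {F E M : Type} [Field F] [Field E] [Field M] [Algebra F E] [Algebra F M] [Algebra E M]
  [IsScalarTower F E M] [Normal F E]

/-- `g ∈ ker(res_E)` iff `g` fixes `E ⊆ M` pointwise. [cite: SerreLocalFields1979, Ch. XI §1 (iv)] -/
theorem mem_ker_restrictNormalHom_iff (g : M ≃ₐ[F] M) :
    g ∈ (AlgEquiv.restrictNormalHom (F := F) (K₁ := M) E).ker ↔ ∀ e : E, g (algebraMap E M e) = algebraMap E M e := by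
  rw [MonoidHom.mem_ker]
  constructor
  · intro h e
    have h1 := AlgEquiv.restrictNormal_commutes g E e
    change algebraMap E M ((AlgEquiv.restrictNormalHom E g) e) = _ at h1
    rw [h, AlgEquiv.one_apply] at h1
    exact h1.symm
  · intro h
    refine AlgEquiv.ext fun e => (algebraMap E M).injective ?_
    change algebraMap E M ((g.restrictNormal E) e) = _
    rw [AlgEquiv.restrictNormal_commutes, h, AlgEquiv.one_apply]

/-- An `E`-automorphism of `M`, regarded in `Gal(M/F)`, lies in `ker(res_E)`.
[cite: SerreLocalFields1979, Ch. XI §1 (iv)] -/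
theorem restrictScalars_mem_ker (σ : M ≃ₐ[E] M) :
    σ.restrictScalars F ∈ (AlgEquiv.restrictNormalHom (F := F) (K₁ := M) E).ker :=
  (mem_ker_restrictNormalHom_iff _).2 fun e => σ.commutes e

/-- Conversely every element of `ker(res_E)` is an `E`-automorphism of `M`.
[cite: SerreLocalFields1979, Ch. XI §1 (iv)] -/
theorem exists_restrictScalars_eq_of_mem_ker {g : M ≃ₐ[F] M}
    (hg : g ∈ (AlgEquiv.restrictNormalHom (F := F) (K₁ := M) E).ker) :
    ∃ σ : M ≃ₐ[E] M, σ.restrictScalars F = g :=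
  ⟨{ (g : M ≃ₐ[F] M).toRingEquiv with commutes' := (mem_ker_restrictNormalHom_iff g).1 hg },
    AlgEquiv.ext fun _ => rfl⟩

/-- `σ ↦ σ|^F` is a bijection `Gal(M/E) ≃ ker(res_E)`. [cite: SerreLocalFields1979, Ch. XI §1 (iv)] -/
theorem bijective_restrictScalars_codRestrict_ker :
    Function.Bijective fun σ : M ≃ₐ[E] M =>
      (⟨σ.restrictScalars F, restrictScalars_mem_ker σ⟩ : (AlgEquiv.restrictNormalHom (F := F) (K₁ := M) E).ker) := by
  refine ⟨fun σ τ h => AlgEquiv.restrictScalars_injective F (congrArg Subtype.val h), fun g => ?_⟩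
  obtain ⟨σ, hσ⟩ := exists_restrictScalars_eq_of_mem_ker (F := F) (E := E) (M := M) g.2
  exact ⟨σ, Subtype.ext hσ⟩

variable [Normal F M] [FiniteDimensional F E]

/-- **`#(Gal(M/F) ⧸ ker res_E) = [E : F]`** (`res_E` is onto `Gal(E/F)`, of order `[E:F]`).
[cite: CasselsFrohlichANT1967, Ch. VII §8] -/
theorem natCard_quotient_ker_restrictNormalHom [IsGalois F E] :
    Nat.card ((M ≃ₐ[F] M) ⧸ (AlgEquiv.restrictNormalHom (F := F) (K₁ := M) E).ker) = Module.finrank F E := by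
  rw [Nat.card_congr (QuotientGroup.quotientKerEquivOfSurjective _
    (AlgEquiv.restrictNormalHom_surjective (F := F) (K₁ := E) (E := M))).toEquiv,
    IsGalois.card_aut_eq_finrank]

end Kernel

/-! ## §2. The quotient layer by `ker(res_E)` is the layer `(Gal(E/F), C_E)` -/

section Layer

variable {F E M : Type} [Field F] [Field E] [Field M] [Algebra F E] [Algebra F M] [Algebra E M]
  [IsScalarTower F E M] [NumberField F] [NumberField E] [NumberField M] [IsGalois F E] [IsGalois F M]

/-- The descent identification `C_E ≅ (C_M)^{ker res_E}`, `a ↦ ι_{M/E}(a)`, as a `ℤ`-linear equivalence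
(injective: `classBaseChange_injective`; onto: Galois descent for `M/E`, `mem_range_classBaseChange_iff`, since
`ker res_E = Gal(M/E)`). [cite: CasselsFrohlichANT1967, Ch. VII §8 Prop. 8.1] -/
theorem exists_descentEquiv_ker :
    ∃ φ : (galoisRep F E).V ≃ₗ[ℤ]
        ((galoisRep F M).quotientToInvariants (AlgEquiv.restrictNormalHom (F := F) (K₁ := M) E).ker).V,
      ∀ a, ((φ a : ((galoisRep F M).quotientToInvariants
          (AlgEquiv.restrictNormalHom (F := F) (K₁ := M) E).ker).V) : (galoisRep F M).V) =
        Additive.ofMul (classBaseChange E M (Additive.toMul (α := IdeleClassGroup E) a)) := by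
  haveI : IsGalois E M := IsGalois.tower_top_of_isGalois F E M
  set H := (AlgEquiv.restrictNormalHom (F := F) (K₁ := M) E).ker with hH
  set ι : IdeleClassGroup E →* IdeleClassGroup M := classBaseChange E M with hι
  -- `ι(a)` is `H`-invariant
  have hinv : ∀ (a : IdeleClassGroup E) (h : H), classGalAct (h : M ≃ₐ[F] M) (ι a) = ι a := fun a h => by
    rw [hι, classGalAct_classBaseChange_tower (h : M ≃ₐ[F] M) a]
    have h1 : (h : M ≃ₐ[F] M).restrictNormal E = 1 := h.2
    rw [h1]
    congr 1
    induction a using QuotientGroup.induction_on with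
    | H y => rw [classGalAct_mk, one_smul]
  let t : (galoisRep F E).V → ((galoisRep F M).quotientToInvariants H).V := fun a =>
    ⟨Additive.ofMul (ι (Additive.toMul (α := IdeleClassGroup E) a)), fun h => by
      change Additive.ofMul (classGalAct ((h : H) : M ≃ₐ[F] M) (ι (Additive.toMul (α := IdeleClassGroup E) a))) =
        Additive.ofMul (ι (Additive.toMul (α := IdeleClassGroup E) a))
      exact congrArg Additive.ofMul (hinv _ h)⟩
  have ht : ∀ a, ((t a : ((galoisRep F M).quotientToInvariants H).V) : (galoisRep F M).V) =
      Additive.ofMul (ι (Additive.toMul (α := IdeleClassGroup E) a)) := fun a => rfl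
  have hadd : ∀ a b, t (a + b) = t a + t b := fun a b => Subtype.ext (by
    rw [ht]
    exact congrArg Additive.ofMul (map_mul ι (Additive.toMul (α := IdeleClassGroup E) a)
      (Additive.toMul (α := IdeleClassGroup E) b)))
  let ψ : (galoisRep F E).V →ₗ[ℤ] ((galoisRep F M).quotientToInvariants H).V :=
    AddMonoidHom.toIntLinearMap (AddMonoidHom.mk' t hadd)
  have hψ : ∀ a, ψ a = t a := fun a => rfl
  have hinj : Function.Injective ψ := fun a b hab => by
    have h : ι (Additive.toMul (α := IdeleClassGroup E) a) = ι (Additive.toMul (α := IdeleClassGroup E) b) :=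
      congrArg (fun x : ((galoisRep F M).quotientToInvariants H).V =>
        Additive.toMul (α := IdeleClassGroup M) (x : (galoisRep F M).V)) hab
    exact congrArg Additive.ofMul (classBaseChange_injective E M h)
  have hsurj : Function.Surjective ψ := fun x => by
    have hx : ∀ σ : M ≃ₐ[E] M, classGalAct σ (Additive.toMul (α := IdeleClassGroup M) (x : (galoisRep F M).V)) =
        Additive.toMul (α := IdeleClassGroup M) (x : (galoisRep F M).V) := fun σ => by
      rw [← classGalAct_restrictScalars (F := F) σ]
      exact congrArg Additive.toMul (x.2 ⟨σ.restrictScalars F, restrictScalars_mem_ker σ⟩)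
    obtain ⟨a, ha⟩ := (mem_range_classBaseChange_iff (F := E)
      (Additive.toMul (α := IdeleClassGroup M) (x : (galoisRep F M).V))).2 hx
    exact ⟨Additive.ofMul a, Subtype.ext (by rw [hψ, ht]; exact congrArg Additive.ofMul ha)⟩
  exact ⟨LinearEquiv.ofBijective ψ ⟨hinj, hsurj⟩, fun a => ht a⟩

/-- **`Hⁿ(Gal(M/F) ⧸ ker res_E, (C_M)^{ker res_E}) ≅ Hⁿ(Gal(E/F), C_E)`**: the quotient layer of `galoisRep F M`
by `Gal(M/E) = ker res_E` is the Galois layer `E / F`, for an abstract normal intermediate extension `E`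
(transport of structure along `Gal(M/F) ⧸ ker ≅ Gal(E/F)` and the Galois descent `(C_M)^{Gal(M/E)} = ι(C_E)`,
equivariant by `classGalAct_classBaseChange_tower`). [cite: SerreLocalFields1979, Ch. XI §1 (iv)]
[cite: CasselsFrohlichANT1967, Ch. VII §8 Prop. 8.1] -/
theorem nonempty_iso_quotientToInvariants_ker_galoisRep (n : ℕ) :
    Nonempty (groupCohomology ((galoisRep F M).quotientToInvariants
        (AlgEquiv.restrictNormalHom (F := F) (K₁ := M) E).ker) n ≅ groupCohomology (galoisRep F E) n) := by
  set H := (AlgEquiv.restrictNormalHom (F := F) (K₁ := M) E).ker with hH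
  obtain ⟨φ, hφ⟩ := exists_descentEquiv_ker (F := F) (E := E) (M := M)
  let e : (M ≃ₐ[F] M) ⧸ H ≃* (E ≃ₐ[F] E) :=
    QuotientGroup.quotientKerEquivOfSurjective _
      (AlgEquiv.restrictNormalHom_surjective (F := F) (K₁ := E) (E := M))
  have he_mk : ∀ g : M ≃ₐ[F] M, e (g : (M ≃ₐ[F] M) ⧸ H) = g.restrictNormal E := fun _ => rfl
  -- equivariance of `φ.symm` along `e`
  have he : ∀ q : (M ≃ₐ[F] M) ⧸ H,
      φ.symm.toLinearMap ∘ₗ ((galoisRep F M).quotientToInvariants H).ρ q =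
        (galoisRep F E).ρ (e q) ∘ₗ φ.symm.toLinearMap := fun q => by
    induction q using QuotientGroup.induction_on with
    | H g =>
      refine LinearMap.ext fun x => ?_
      obtain ⟨a, rfl⟩ := φ.surjective x
      change φ.symm (((galoisRep F M).quotientToInvariants H).ρ (g : (M ≃ₐ[F] M) ⧸ H) (φ a)) =
        (galoisRep F E).ρ (e (g : (M ≃ₐ[F] M) ⧸ H)) (φ.symm (φ a))
      rw [φ.symm_apply_apply, he_mk]
      apply φ.injective
      rw [φ.apply_symm_apply]
      apply Subtype.ext
      change (galoisRep F M).ρ g (φ a : (galoisRep F M).V) = _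
      rw [hφ, hφ, galoisRep_ρ_apply, galoisRep_ρ_apply, toMul_ofMul, toMul_ofMul]
      exact congrArg Additive.ofMul (classGalAct_classBaseChange_tower g _)
  exact ⟨groupCohomology.mapIso e φ.symm he n⟩

/-- `#Hⁿ(Gal(M/F) ⧸ ker res_E, (C_M)^{ker res_E}) = #Hⁿ(Gal(E/F), C_E)`.
[cite: SerreLocalFields1979, Ch. XI §1 (iv)] -/
theorem natCard_groupCohomology_quotientToInvariants_ker (n : ℕ) :
    Nat.card (groupCohomology ((galoisRep F M).quotientToInvariants
        (AlgEquiv.restrictNormalHom (F := F) (K₁ := M) E).ker) n) =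
      Nat.card (groupCohomology (galoisRep F E) n) := by
  obtain ⟨i⟩ := nonempty_iso_quotientToInvariants_ker_galoisRep (F := F) (E := E) (M := M) n
  exact Nat.card_congr i.toLinearEquiv.toEquiv

/-- `Hⁿ(Gal(E/F), C_E)` is cyclic iff the quotient layer `Hⁿ(Gal(M/F) ⧸ ker res_E, (C_M)^{ker res_E})` is.
[cite: SerreLocalFields1979, Ch. XI §1 (iv)] -/
theorem isAddCyclic_groupCohomology_galoisRep_of_quotientToInvariants_ker (n : ℕ)
    (h : IsAddCyclic (groupCohomology ((galoisRep F M).quotientToInvariants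
        (AlgEquiv.restrictNormalHom (F := F) (K₁ := M) E).ker) n)) :
    IsAddCyclic (groupCohomology (galoisRep F E) n) := by
  obtain ⟨i⟩ := nonempty_iso_quotientToInvariants_ker_galoisRep (F := F) (E := E) (M := M) n
  exact isAddCyclic_of_surjective i.toLinearEquiv.toAddMonoidHom i.toLinearEquiv.surjective

/-! ## §3. A class of order `[E:F]` in the quotient layer when `E/F` is cyclic -/

/-- **For `E/F` cyclic, `H²(Gal(M/F) ⧸ ker res_E, (C_M)^{ker res_E})` has a class of order
`#(Gal(M/F) ⧸ ker res_E) = [E:F]`** — `H²(Gal(E/F), C_E)` is cyclic of order `[E:F]` for a cyclic layer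
(the first and second inequalities, door-c6 g8 `isAddCyclic_H2_galoisRep` / `natCard_H2_galoisRep_eq_card`),
transported by §2.  This is the input `u` of the cyclic reference layer `L' = E` in Neukirch III §6 (6.3).
[cite: CasselsFrohlichANT1967, Ch. VII §11.2 (bis)][cite: CasselsFrohlichANT1967, Ch. VII §9 Thm. 9.1] -/
theorem exists_addOrderOf_eq_card_quotient_ker_of_isCyclic [IsCyclic (E ≃ₐ[F] E)] :
    ∃ u : groupCohomology ((galoisRep F M).quotientToInvariants
        (AlgEquiv.restrictNormalHom (F := F) (K₁ := M) E).ker) 2,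
      addOrderOf u = Nat.card ((M ≃ₐ[F] M) ⧸ (AlgEquiv.restrictNormalHom (F := F) (K₁ := M) E).ker) := by
  obtain ⟨i⟩ := nonempty_iso_quotientToInvariants_ker_galoisRep (F := F) (E := E) (M := M) 2
  haveI := isAddCyclic_H2_galoisRep (F := F) (E := E)
  obtain ⟨g, hg⟩ := IsAddCyclic.exists_ofOrder_eq_natCard (α := groupCohomology (galoisRep F E) 2)
  refine ⟨i.toLinearEquiv.symm g, ?_⟩
  have h1 : addOrderOf (i.toLinearEquiv.symm g) = addOrderOf g :=
    addOrderOf_injective i.toLinearEquiv.symm.toAddMonoidHom i.toLinearEquiv.symm.injective g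
  rw [h1, hg, natCard_H2_galoisRep_eq_card, natCard_quotient_ker_restrictNormalHom,
    IsGalois.card_aut_eq_finrank]

/-! ## §4. `ι_{M/E}` of the norm group of `M/E` lies in the norm of `Res_{ker res_E} C_M` -/

omit [NumberField F] [IsGalois F M] in
/-- The norm of the restricted representation `Res_H C_M`, `H = ker res_E`, agrees with the norm of the layer
`(Gal(M/E), C_M)` (reindex along `Gal(M/E) ≃ H`, `σ ↦ σ|^F`; `classGalAct_restrictScalars`).
[cite: CasselsFrohlichANT1967, Ch. VII §8] -/
theorem norm_res_ker_apply [Fintype (AlgEquiv.restrictNormalHom (F := F) (K₁ := M) E).ker]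
    (b : Additive (IdeleClassGroup M)) :
    (Rep.res (AlgEquiv.restrictNormalHom (F := F) (K₁ := M) E).ker.subtype (galoisRep F M)).ρ.norm b =
      (galoisRep E M).ρ.norm b := by
  rw [Representation.norm, LinearMap.coe_sum, Finset.sum_apply, Representation.norm, LinearMap.coe_sum,
    Finset.sum_apply]
  symm
  refine Fintype.sum_bijective _ (bijective_restrictScalars_codRestrict_ker (F := F) (E := E) (M := M)) _ _
    fun σ => ?_
  change (galoisRep E M).ρ σ b = (galoisRep F M).ρ (σ.restrictScalars F) b
  rw [galoisRep_ρ_apply, galoisRep_ρ_apply, classGalAct_restrictScalars]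

omit [NumberField F] [IsGalois F M] in
/-- **`ι_{M/E}[Eˣ N_{M/E} 𝕀_M] ⊆ N_H C_M` for `H = ker res_E = Gal(M/E)`**: the class of a norm-group idèle of
`M/E`, base-changed to `C_M`, is a norm of the restricted representation `Res_H (galoisRep F M)` — the shape of
the translation input `hT` of `Literature.Algebra.Homology.CyclicReference.exists_addOrderOf_eq_card_quotient`.
[cite: CasselsFrohlichANT1967, Ch. VII §9 Thm. 9.1 (proof, Step 2)][cite: CasselsFrohlichANT1967, Ch. VII §11.2] -/
theorem ofMul_classBaseChange_mem_range_norm_res_ker [Fintype (AlgEquiv.restrictNormalHom (F := F) (K₁ := M) E).ker]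
    {y : ideleGroup E} (hy : y ∈ normGroup E M) :
    Additive.ofMul (classBaseChange E M (y : IdeleClassGroup E)) ∈
      LinearMap.range (Rep.res (AlgEquiv.restrictNormalHom (F := F) (K₁ := M) E).ker.subtype (galoisRep F M)).ρ.norm := by
  obtain ⟨b, hb⟩ := classBaseChange_mem_range_norm_of_mem_normGroup (F := E) (E := M) hy
  exact ⟨b, (norm_res_ker_apply (F := F) (E := E) (M := M) b).trans hb⟩

end Layer

end IdeleClassGroup

end Literature.NumberTheory.Automorphic

end
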